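import Literature.Geometry.Lorentzian.CausalFutureProofs
import Literature.Geometry.Lorentzian.LorentzianDistance
import Literature.Geometry.Lorentzian.GeodesicProofs
import HarnessLib

/-!
# Prefixing a causal curve: the time separation is monotone in its first argument

For a `Cⁿ` (`n ≥ 1`) time-oriented Lorentzian metric on a manifold without boundary we prove the
half of O'Neill's reverse triangle inequality (O'Neill 1983, Ch. 14, Lemma 14.16 (2), p. 409:
"If `p ≤ q ≤ r`, then `τ(p, q) + τ(q, r) ≤ τ(p, r)`") which drops the first summand:

* `LorentzianMetric.arcLength_le_lorentzDist_of_mem_causalFuture` — a future causal curve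
  `γ : [a, b] → M` with `γ a ∈ J⁺(p)` has `L(γ) ≤ d(p, γ b)`;
* `LorentzianMetric.lorentzDist_le_lorentzDist_of_mem_causalFuture` — `d(q, r) ≤ d(p, r)` for
  `q ∈ J⁺(p)`.

O'Neill's causal curves are piecewise smooth, so for him `α + β` is again a causal curve and the
inequality is immediate from the definition of `τ` as a supremum of lengths. The tree's causal
curves (`LorentzianMetric.IsFutureCausalCurveOn`) are differentiable at *every* parameter, so the
corner of a concatenation has to be rounded off, which changes the curve near the junction. The
technical core of the file is therefore

* `LorentzianMetric.exists_isFutureCausalCurveOn_trans_tail` — the concatenation with rounded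
  corner of `Literature.Geometry.Lorentzian.CausalFutureProofs`
  (`exists_isFutureCausalCurveOn_trans`, whose proof is followed line by line), with the by-product
  exported: given `η > 0`, the resulting causal curve from `γ₁ a₁` to `γ₂ b₂` *coincides with a
  translate of `γ₂` on a final parameter interval covering `γ₂|[a₂ + η, b₂]`* (in the case of
  proportional velocities at the junction the *first* curve is reparametrised, so that all of `γ₂`
  is kept);

together with two elementary facts about the arc length of
`Literature.Geometry.Lorentzian.LorentzianDistance`: invariance under translation of the
parameter (`PseudoRiemannianMetric.arcLength_comp_add_const`) and exhaustion from the inside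
(`PseudoRiemannianMetric.arcLength_le_of_forall_lt`: the lower Lebesgue integral over `(a, b]` is
the supremum of the integrals over `[a', b]`, `a' ↓ a`, with no measurability assumption —
Mathlib's `MeasureTheory.setLIntegral_iUnion_of_directed`). Letting `η → 0` gives the length
estimate. Everything is proved; no definitions and no named facts are introduced. Deliberately NOT
here: the full reverse triangle inequality (it needs in addition the invariance of arc length
under affine reparametrisation, for the proportional case) and O'Neill's Lemma 14.16 (1).

## References

* B. O'Neill, *Semi-Riemannian geometry with applications to relativity*, Academic Press 1983,
  Ch. 14, Def. 14.15 and Lemma 14.16 (p. 409), p. 402 (transitivity of `≤`); Ch. 10, Prop. 10.46;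
  Ch. 5, Def. 5.11 (arc length). Key `ONeillSemiRiemannian1983`.
-/

-- `maxSynthPendingDepth 2`: instance search on the nested operator space `E →L[ℝ] E →L[ℝ] ℝ`
-- (the model fibre of the bundle of bilinear forms) needs one more pending level than the default.
set_option maxSynthPendingDepth 2

noncomputable section

open Bundle Set Filter Function MeasureTheory
open scoped Manifold ContDiff Topology ENNReal

namespace Literature.Geometry.Lorentzian

variable {E : Type*} [NormedAddCommGroup E] [NormedSpace ℝ E] {H : Type*} [TopologicalSpace H]
  {I : ModelWithCorners ℝ E H} {n : ℕ∞ω} {M : Type*} [TopologicalSpace M] [ChartedSpace H M]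
  [IsManifold I ∞ M]

namespace LorentzianMetric

variable {g : LorentzianMetric I n M} {τ : TimeOrientation g}

/-- **Concatenation of causal curves with rounded corner, keeping the tail of the second curve.**
Same construction as `exists_isFutureCausalCurveOn_trans` (O'Neill 1983, Ch. 14, p. 402, with the
corner at the junction rounded off for everywhere-differentiable curves), with the by-product
exported: given `η > 0`, the resulting future causal curve `γ : [a, b] → M` from `γ₁ a₁` to
`γ₂ b₂` coincides on a final parameter interval `(s₀, b]` with the translate `γ₂ (· + c)`, and
this tail covers `γ₂` on `[a₂ + η, b₂]` (`s₀ + c ≤ a₂ + η`, `b + c = b₂`): the modification of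
`γ₂` is confined to the parameter interval `[a₂, a₂ + η]`. In the case of proportional velocities
at the junction it is the *first* curve which is reparametrised, so that the whole of `γ₂` is kept.
[cite: ONeillSemiRiemannian1983, Ch. 14, p. 402 and Ch. 10, Prop. 10.46] -/
theorem exists_isFutureCausalCurveOn_trans_tail [BoundarylessManifold I M] (hn : 1 ≤ n)
    {γ₁ γ₂ : ℝ → M} {a₁ b₁ a₂ b₂ : ℝ} (hab₁ : a₁ < b₁) (hab₂ : a₂ < b₂)
    (hγ₁ : g.IsFutureCausalCurveOn τ γ₁ (Icc a₁ b₁)) (hγ₂ : g.IsFutureCausalCurveOn τ γ₂ (Icc a₂ b₂))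
    (hjoin : γ₁ b₁ = γ₂ a₂) {η : ℝ} (hη : 0 < η) :
    ∃ (γ : ℝ → M) (a b s₀ c : ℝ), a < b ∧ g.IsFutureCausalCurveOn τ γ (Icc a b) ∧
      γ a = γ₁ a₁ ∧ γ b = γ₂ b₂ ∧ a ≤ s₀ ∧ s₀ < b ∧ b + c = b₂ ∧ s₀ + c ≤ a₂ + η ∧
      ∀ s ∈ Ioc s₀ b, γ s = γ₂ (s + c) := by
  -- the junction point and its chart
  set p : M := γ₁ b₁ with hpdef
  set φ := extChartAt I p with hφ
  set x₀ : E := φ p with hx₀def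
  have hps : p ∈ (chartAt H p).source := mem_chart_source H p
  have hx₀t : x₀ ∈ φ.target := (extChartAt I p).map_source (mem_extChartAt_source p)
  have hx₀p : φ.symm x₀ = p := (extChartAt I p).left_inv (mem_extChartAt_source p)
  -- a ball of the model space inside the chart target (no boundary)
  obtain ⟨R, hR, hballR⟩ : ∃ R : ℝ, 0 < R ∧ Metric.ball x₀ R ⊆ φ.target := by
    have hint : x₀ ∈ interior φ.target :=
      ModelWithCorners.isInteriorPoint_iff.mp (BoundarylessManifold.isInteriorPoint (I := I))
    exact Metric.mem_nhds_iff.mp (mem_interior_iff_mem_nhds.mp hint)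
  have hballR' : ∀ x : E, ‖x - x₀‖ < R → x ∈ φ.target :=
    fun x hx ↦ hballR (by rwa [Metric.mem_ball, dist_eq_norm])
  have htn : ∀ x : E, ‖x - x₀‖ < R → φ.target ∈ 𝓝 x := fun x hx ↦
    Filter.mem_of_superset (Metric.isOpen_ball.mem_nhds (by rwa [Metric.mem_ball, dist_eq_norm]))
      hballR
  -- the metric and the time orientation in coordinates
  set G : E → E →L[ℝ] E →L[ℝ] ℝ := g.coordMetric p with hGdef
  set Tc : E → E := τ.coordTime p with hTcdef
  have hGcd : ContDiffOn ℝ 1 G φ.target := g.contDiffOn_coordMetric hn p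
  have hGd : ∀ x, ‖x - x₀‖ < R → DifferentiableAt ℝ G x := fun x hx ↦
    ((hGcd.differentiableOn one_ne_zero) x (hballR' x hx)).differentiableAt (htn x hx)
  have hTc : ∀ x, ‖x - x₀‖ < R → ContinuousAt (fun x ↦ G x (Tc x)) x := fun x hx ↦
    ((hGcd.continuousOn.clm_apply (τ.continuousOn_coordTime hn p)) x (hballR' x hx)).continuousAt
      (htn x hx)
  have hsymm : ∀ x, ‖x - x₀‖ < R → ∀ v w, G x v w = G x w v :=
    fun x hx v w ↦ g.coordMetric_comm (hballR' x hx) v w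
  -- the timecone inequality, transported to coordinates
  have hcone : ∀ x, ‖x - x₀‖ < R → ∀ v w, G x v v ≤ 0 → v ≠ 0 → G x (Tc x) v < 0 →
      G x w w < 0 → G x (Tc x) w < 0 → G x v w < 0 := by
    intro x hx v w hvv hv0 hvf hww hwf
    have hxt := hballR' x hx
    have hw0 : w ≠ 0 := fun h ↦ by rw [h, map_zero] at hwf; exact lt_irrefl 0 hwf
    have hv : τ.IsFutureDirected _ := (isFutureDirected_symmL_iff (τ := τ) hxt v).mpr ⟨⟨hvv, hv0⟩, hvf⟩
    have hw : τ.IsFutureDirected _ :=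
      (isFutureDirected_symmL_iff (τ := τ) hxt w).mpr ⟨⟨hww.le, hw0⟩, hwf⟩
    have hwt : g.IsTimelike _ := (isTimelike_symmL_iff (g := g) hxt w).mpr hww
    have key := hw.val_lt_zero τ hwt hv
    rw [g.symm] at key
    rwa [← g.coordMetric_apply hxt v w] at key
  -- a neighbourhood of the junction which the chart maps into the ball
  set N : Set M := φ.source ∩ φ ⁻¹' Metric.ball x₀ R with hNdef
  have hN : N ∈ 𝓝 p := Filter.inter_mem (extChartAt_source_mem_nhds p)
    ((continuousAt_extChartAt p).preimage_mem_nhds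
      (Metric.isOpen_ball.mem_nhds (Metric.mem_ball_self hR)))
  have hNs : ∀ y ∈ N, y ∈ (chartAt H p).source := fun y hy ↦ by
    rw [← extChartAt_source I p]; exact hy.1
  have hNb : ∀ y ∈ N, ‖φ y - x₀‖ < R := fun y hy ↦ by
    have := hy.2; rwa [mem_preimage, Metric.mem_ball, dist_eq_norm] at this
  -- continuity of `γ₁` at `b₁` and of `γ₂` at `a₂`
  have hc₁b : ContinuousAt γ₁ b₁ := (hγ₁ b₁ ⟨hab₁.le, le_rfl⟩).1.continuousAt
  have hc₂a : ContinuousAt γ₂ a₂ := (hγ₂ a₂ ⟨le_rfl, hab₂.le⟩).1.continuousAt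
  obtain ⟨d₁, hd₁, hd₁N⟩ : ∃ d : ℝ, 0 < d ∧ ∀ t, |t - b₁| < d → γ₁ t ∈ N := by
    have := hc₁b.preimage_mem_nhds hN
    rw [Metric.mem_nhds_iff] at this
    obtain ⟨d, hd, h⟩ := this
    exact ⟨d, hd, fun t ht ↦ h (by rwa [Metric.mem_ball, Real.dist_eq])⟩
  obtain ⟨d₂, hd₂, hd₂N⟩ : ∃ d : ℝ, 0 < d ∧ ∀ t, |t - a₂| < d → γ₂ t ∈ N := by
    have hN' : N ∈ 𝓝 (γ₂ a₂) := by rwa [← hjoin]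
    have := hc₂a.preimage_mem_nhds hN'
    rw [Metric.mem_nhds_iff] at this
    obtain ⟨d, hd, h⟩ := this
    exact ⟨d, hd, fun t ht ↦ h (by rwa [Metric.mem_ball, Real.dist_eq])⟩
  -- the scale `δ₀`
  obtain ⟨δ₀, hδ₀, hδ₀1, hδ₀2, hδ₀3, hδ₀4⟩ : ∃ δ : ℝ, 0 < δ ∧ 2 * δ ≤ d₁ ∧ 2 * δ ≤ d₂ ∧
      2 * δ ≤ b₁ - a₁ ∧ 2 * δ ≤ b₂ - a₂ := by
    refine ⟨min (min (d₁ / 2) (d₂ / 2)) (min ((b₁ - a₁) / 2) ((b₂ - a₂) / 2)),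
      lt_min (lt_min (by positivity) (by positivity)) (lt_min (by linarith) (by linarith)),
      ?_, ?_, ?_, ?_⟩
    · have := (min_le_left _ _).trans (min_le_left (d₁ / 2) (d₂ / 2))
        (a := min (min (d₁ / 2) (d₂ / 2)) (min ((b₁ - a₁) / 2) ((b₂ - a₂) / 2)))
      linarith
    · have := (min_le_left _ _).trans (min_le_right (d₁ / 2) (d₂ / 2))
        (a := min (min (d₁ / 2) (d₂ / 2)) (min ((b₁ - a₁) / 2) ((b₂ - a₂) / 2)))
      linarith
    · have := (min_le_right _ _).trans (min_le_left ((b₁ - a₁) / 2) ((b₂ - a₂) / 2))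
        (a := min (min (d₁ / 2) (d₂ / 2)) (min ((b₁ - a₁) / 2) ((b₂ - a₂) / 2)))
      linarith
    · have := (min_le_right _ _).trans (min_le_right ((b₁ - a₁) / 2) ((b₂ - a₂) / 2))
        (a := min (min (d₁ / 2) (d₂ / 2)) (min ((b₁ - a₁) / 2) ((b₂ - a₂) / 2)))
      linarith
  have hγ₁N : ∀ s, |s| < 2 * δ₀ → γ₁ (s + b₁) ∈ N := fun s hs ↦
    hd₁N _ (by rw [add_sub_cancel_right]; linarith)
  have hγ₂N : ∀ s, |s| < 2 * δ₀ → γ₂ (s + a₂) ∈ N := fun s hs ↦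
    hd₂N _ (by rw [add_sub_cancel_right]; linarith)
  -- the two curves in coordinates, parametrised so that the corner is at `0`
  set c₁ : ℝ → E := fun s ↦ φ (γ₁ (s + b₁)) with hc₁def
  set u₁ : ℝ → E := fun s ↦ (trivializationAt E (TangentSpace I) p).continuousLinearMapAt ℝ
    (γ₁ (s + b₁)) (velocity I γ₁ (s + b₁)) with hu₁def
  set c₂ : ℝ → E := fun s ↦ φ (γ₂ (s + a₂)) with hc₂def
  set u₂ : ℝ → E := fun s ↦ (trivializationAt E (TangentSpace I) p).continuousLinearMapAt ℝ
    (γ₂ (s + a₂)) (velocity I γ₂ (s + a₂)) with hu₂def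
  have hc₁ : ∀ s ∈ Icc (-δ₀) 0, HasDerivAt c₁ (u₁ s) s ∧ ‖c₁ s - x₀‖ < R ∧
      (G (c₁ s) (u₁ s) (u₁ s) ≤ 0 ∧ u₁ s ≠ 0) ∧ G (c₁ s) (Tc (c₁ s)) (u₁ s) < 0 := by
    intro s hs
    have hyN : γ₁ (s + b₁) ∈ N := hγ₁N s (by rw [abs_lt]; constructor <;> linarith [hs.1, hs.2])
    have hy := hNs _ hyN
    obtain ⟨hmd, hfd⟩ := hγ₁ (s + b₁) ⟨by linarith [hs.1], by linarith [hs.2]⟩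
    exact ⟨(hasDerivAt_extChartAt_comp_continuousLinearMapAt (p := p) hmd hy).comp_add_const s b₁, hNb _ hyN,
      (isFutureDirected_iff_coord hy _).mp hfd⟩
  have hc₂ : ∀ s ∈ Icc 0 δ₀, HasDerivAt c₂ (u₂ s) s ∧ ‖c₂ s - x₀‖ < R ∧
      (G (c₂ s) (u₂ s) (u₂ s) ≤ 0 ∧ u₂ s ≠ 0) ∧ G (c₂ s) (Tc (c₂ s)) (u₂ s) < 0 := by
    intro s hs
    have hyN : γ₂ (s + a₂) ∈ N := hγ₂N s (by rw [abs_lt]; constructor <;> linarith [hs.1, hs.2])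
    have hy := hNs _ hyN
    obtain ⟨hmd, hfd⟩ := hγ₂ (s + a₂) ⟨by linarith [hs.1], by linarith [hs.2]⟩
    exact ⟨(hasDerivAt_extChartAt_comp_continuousLinearMapAt (p := p) hmd hy).comp_add_const s a₂, hNb _ hyN,
      (isFutureDirected_iff_coord hy _).mp hfd⟩
  have h₁0 : c₁ 0 = x₀ := by simp [hc₁def, hx₀def, hpdef]
  have h₂0 : c₂ 0 = x₀ := by
    show φ (γ₂ (0 + a₂)) = φ p
    rw [zero_add, ← hjoin]
  -- the velocities at the corner, in coordinates and pulled back to `T_p M`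
  obtain ⟨-, -, ⟨hv₁c, hv₁0⟩, hv₁f⟩ := hc₁ 0 ⟨by linarith, le_rfl⟩
  obtain ⟨-, -, ⟨hv₂c, hv₂0⟩, hv₂f⟩ := hc₂ 0 ⟨le_rfl, hδ₀.le⟩
  rw [h₁0] at hv₁c hv₁f
  rw [h₂0] at hv₂c hv₂f
  set ψ := (trivializationAt E (TangentSpace I) p).symmL ℝ (φ.symm x₀) with hψ
  have hw₁ : τ.IsFutureDirected (ψ (u₁ 0)) :=
    (isFutureDirected_symmL_iff (τ := τ) hx₀t (u₁ 0)).mpr ⟨⟨hv₁c, hv₁0⟩, hv₁f⟩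
  have hw₂ : τ.IsFutureDirected (ψ (u₂ 0)) :=
    (isFutureDirected_symmL_iff (τ := τ) hx₀t (u₂ 0)).mpr ⟨⟨hv₂c, hv₂0⟩, hv₂f⟩
  -- the reparametrised first curve
  have hγ₁' : g.IsFutureCausalCurveOn τ (fun s ↦ γ₁ (s + b₁)) (Icc (a₁ - b₁) 0) := by
    have := hγ₁.comp_add_const b₁; rwa [sub_self] at this
  by_cases hpar : ∃ c : ℝ, 0 < c ∧ u₂ 0 = c • u₁ 0
  · /- **Proportional velocities**: reparametrise `γ₁` affinely so that the two velocities at the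
    junction agree; the concatenation is then differentiable at the junction and contains the
    translate of the whole of `γ₂`. -/
    obtain ⟨c, hc, hcu⟩ := hpar
    -- the coordinate curve through the junction: `c₁` rescaled by `c`, then `c₂`
    set ĉ : ℝ → E := CausalCurveGluing.glueAt 0 (fun s ↦ c₁ (c * s)) c₂ with hĉ
    have hĉd : HasDerivAt ĉ (u₂ 0) 0 := by
      refine CausalCurveGluing.hasDerivAt_glueAt ?_ (hc₂ 0 ⟨le_rfl, hδ₀.le⟩).1 ?_
      · have hd₁ : HasDerivAt c₁ (u₁ 0) (c * 0) := by
          rw [mul_zero]; exact (hc₁ 0 ⟨by linarith, le_rfl⟩).1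
        have h := hd₁.scomp (0 : ℝ) ((hasDerivAt_id (0 : ℝ)).const_mul c)
        refine h.congr_deriv ?_
        rw [hcu, mul_one]
      · simp only [mul_zero, h₁0, h₂0]
    have hm : g.IsFutureCausalCurveOn τ (φ.symm ∘ ĉ) (Icc 0 0) := by
      refine isFutureCausalCurveOn_extChartAt_symm_comp (U := Metric.ball x₀ R)
        Metric.isOpen_ball hballR (u := fun _ ↦ u₂ 0) fun s hs ↦ ?_
      have hs0 : s = 0 := le_antisymm hs.2 hs.1
      subst hs0
      have hĉ0 : ĉ 0 = x₀ := by
        rw [hĉ, CausalCurveGluing.glueAt_of_le le_rfl]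
        show c₁ (c * 0) = x₀
        rw [mul_zero, h₁0]
      refine ⟨hĉd, ?_, ?_⟩
      · rw [hĉ0]; exact Metric.mem_ball_self hR
      · rw [hĉ0]; exact ⟨⟨hv₂c, hv₂0⟩, hv₂f⟩
    -- the rescaled first curve
    have hγ₁'' : g.IsFutureCausalCurveOn τ (fun s ↦ γ₁ (b₁ + c * s)) (Icc ((a₁ - b₁) / c) 0) := by
      have h := hγ₁.comp_of_hasDerivAt (φ := fun s ↦ b₁ + c * s) (φ' := fun _ ↦ c)
        (fun u ↦ by simpa using ((hasDerivAt_id u).const_mul c).const_add b₁) (fun _ ↦ hc)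
      refine fun s hs ↦ h s ?_
      show b₁ + c * s ∈ Icc a₁ b₁
      have h1 : (a₁ - b₁) / c ≤ s := hs.1
      rw [div_le_iff₀ hc] at h1
      have h2 : c * s ≤ 0 := mul_nonpos_of_nonneg_of_nonpos hc.le hs.2
      rw [mul_comm] at h1
      exact ⟨by linarith, by linarith⟩
    -- the translated second curve
    have hγ₂'' : g.IsFutureCausalCurveOn τ (fun s ↦ γ₂ (s + a₂)) (Icc 0 (b₂ - a₂)) := by
      have := hγ₂.comp_add_const a₂; rwa [sub_self] at this
    -- glue
    set δM := min δ₀ (δ₀ / c) with hδM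
    have hδM0 : 0 < δM := lt_min hδ₀ (div_pos hδ₀ hc)
    have hΓ := IsFutureCausalCurveOn.glue (σ₀ := 0) (σ₁ := 0) le_rfl hδM0 hγ₁'' hm hγ₂''
      (fun s hs ↦ by
        have hsN : |c * s| < 2 * δ₀ := by
          have h1 : -δM < s := by linarith [hs.1]
          have h3 : δM ≤ δ₀ / c := min_le_right _ _
          have h4 : c * (δ₀ / c) = δ₀ := mul_div_cancel₀ δ₀ hc.ne'
          have h5 : c * (-δM) < c * s := mul_lt_mul_of_pos_left h1 hc
          have h6 : c * δM ≤ c * (δ₀ / c) := mul_le_mul_of_nonneg_left h3 hc.le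
          have h7 : c * s ≤ 0 := mul_nonpos_of_nonneg_of_nonpos hc.le hs.2
          rw [mul_neg] at h5
          rw [abs_lt]
          exact ⟨by linarith, by linarith⟩
        show φ.symm (ĉ s) = γ₁ (b₁ + c * s)
        rw [hĉ, CausalCurveGluing.glueAt_of_le hs.2, add_comm b₁]
        exact (extChartAt I p).left_inv (hγ₁N (c * s) hsN).1)
      (fun s hs ↦ by
        have hsN : |s| < 2 * δ₀ := by
          rw [abs_lt]; constructor <;> linarith [hs.1, hs.2, min_le_left δ₀ (δ₀ / c)]
        show φ.symm (ĉ s) = γ₂ (s + a₂)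
        rw [hĉ, CausalCurveGluing.glueAt_of_lt hs.1]
        exact (extChartAt I p).left_inv (hγ₂N s hsN).1)
    have hapos : (a₁ - b₁) / c < 0 := div_neg_of_neg_of_pos (by linarith) hc
    have hbpos : 0 < b₂ - a₂ := by linarith
    refine ⟨_, (a₁ - b₁) / c, b₂ - a₂, 0, a₂, by linarith, hΓ, ?_, ?_, hapos.le, hbpos, by ring,
      by linarith, ?_⟩
    · rw [CausalCurveGluing.glueAt_of_le hapos.le]
      show γ₁ (b₁ + c * ((a₁ - b₁) / c)) = γ₁ a₁
      congr 1; field_simp; ring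
    · rw [CausalCurveGluing.glueAt_of_lt hbpos, CausalCurveGluing.glueAt_of_lt hbpos]
      show γ₂ (b₂ - a₂ + a₂) = γ₂ b₂
      rw [sub_add_cancel]
    · intro s hs
      rw [CausalCurveGluing.glueAt_of_lt hs.1, CausalCurveGluing.glueAt_of_lt hs.1]
  · /- **Non-proportional velocities**: their sum is future timelike; round the corner in the
    chart. -/
    have hne : ¬ ∃ c : ℝ, 0 < c ∧ ψ (u₂ 0) = c • ψ (u₁ 0) := by
      rintro ⟨c, hc, hcψ⟩
      refine hpar ⟨c, hc, ?_⟩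
      have hb : φ.symm x₀ ∈ (trivializationAt E (TangentSpace I) p).baseSet := by
        rw [hx₀p]; simp
      have h1 := congrArg ((trivializationAt E (TangentSpace I) p).continuousLinearMapAt ℝ
        (φ.symm x₀)) hcψ
      rwa [map_smul, hψ, Trivialization.continuousLinearMapAt_symmL _ hb,
        Trivialization.continuousLinearMapAt_symmL _ hb] at h1
    have hDt : g.IsTimelike (ψ (u₁ 0) + ψ (u₂ 0)) := hw₁.isTimelike_add hw₂ hne
    have hDf : τ.IsFutureDirected (ψ (u₁ 0) + ψ (u₂ 0)) := hw₁.add τ hw₂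
    rw [← map_add] at hDt hDf
    have hD : G x₀ (u₁ 0 + u₂ 0) (u₁ 0 + u₂ 0) < 0 := (isTimelike_symmL_iff (g := g) hx₀t _).mp hDt
    have hTD : G x₀ (Tc x₀) (u₁ 0 + u₂ 0) < 0 :=
      ((isFutureDirected_symmL_iff (τ := τ) hx₀t _).mp hDf).2
    -- round the corner in coordinates
    obtain ⟨ε, s₄, hε0, hεη, hεδ₀, hεs₄, ĉ, û, hgood, hleftc, hrightc⟩ :=
      CausalCurveGluing.corner_rounding_coord (ε₁ := η) hR hδ₀ hη hGd hTc hsymm hcone hc₁ hc₂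
        h₁0 h₂0 hD hTD
    -- the middle piece is a causal curve
    have hm : g.IsFutureCausalCurveOn τ (φ.symm ∘ ĉ) (Icc (-ε) s₄) :=
      isFutureCausalCurveOn_extChartAt_symm_comp (U := Metric.ball x₀ R) Metric.isOpen_ball hballR
        fun s hs ↦ by
          obtain ⟨hd, hb, hcs⟩ := hgood s hs
          exact ⟨hd, by rwa [Metric.mem_ball, dist_eq_norm], hcs⟩
    -- the reparametrised second curve
    have hγ₂' : g.IsFutureCausalCurveOn τ (fun s ↦ γ₂ (s + (a₂ + ε - s₄)))
        (Icc s₄ (s₄ + (b₂ - a₂ - ε))) := by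
      refine (hγ₂.comp_add_const (a₂ + ε - s₄)).mono (Icc_subset_Icc (by linarith) (by linarith))
    -- glue
    have hΓ := IsFutureCausalCurveOn.glue (σ₀ := -ε) (σ₁ := s₄) hεs₄.le hδ₀
      (hγ₁'.mono (Icc_subset_Icc le_rfl (by linarith))) hm hγ₂'
      (fun s hs ↦ by
        have hsN : |s| < 2 * δ₀ := by rw [abs_lt]; constructor <;> linarith [hs.1, hs.2]
        show φ.symm (ĉ s) = γ₁ (s + b₁)
        rw [hleftc s hs.2]
        exact (extChartAt I p).left_inv (hγ₁N s hsN).1)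
      (fun s hs ↦ by
        have hsN : |s - s₄ + ε| < 2 * δ₀ := by
          rw [abs_lt]; constructor <;> linarith [hs.1, hs.2]
        show φ.symm (ĉ s) = γ₂ (s + (a₂ + ε - s₄))
        rw [hrightc s hs.1.le, show s + (a₂ + ε - s₄) = (s - s₄ + ε) + a₂ by ring]
        exact (extChartAt I p).left_inv (hγ₂N _ hsN).1)
    refine ⟨_, a₁ - b₁, s₄ + (b₂ - a₂ - ε), s₄, a₂ + ε - s₄, by linarith, hΓ, ?_, ?_,
      by linarith, by linarith, by ring, by linarith, ?_⟩
    · rw [CausalCurveGluing.glueAt_of_le (by linarith)]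
      show γ₁ (a₁ - b₁ + b₁) = γ₁ a₁
      rw [sub_add_cancel]
    · rw [CausalCurveGluing.glueAt_of_lt (by linarith), CausalCurveGluing.glueAt_of_lt (by linarith)]
      show γ₂ (s₄ + (b₂ - a₂ - ε) + (a₂ + ε - s₄)) = γ₂ b₂
      congr 1; ring
    · intro s hs
      rw [CausalCurveGluing.glueAt_of_lt (show -ε < s by linarith [hs.1]),
        CausalCurveGluing.glueAt_of_lt hs.1]

end LorentzianMetric

/-! ### Arc length: translates and exhaustion from the inside -/

namespace PseudoRiemannianMetric

variable {g : PseudoRiemannianMetric I n E (TangentSpace I : M → Type _)}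

/-- The speed of the translate `s ↦ γ (s + c)` at `s` is the speed of `γ` at `s + c`. [folklore] -/
lemma speed_comp_add_const (γ : ℝ → M) (c s : ℝ) :
    g.speed (fun t ↦ γ (t + c)) s = g.speed γ (s + c) := by
  have hv : velocity I (fun t ↦ γ (t + c)) s = velocity I γ (s + c) := by
    have h := velocity_comp_affine (I := I) γ 1 c s
    have h1 : (fun t : ℝ ↦ γ (1 * t + c)) = fun t ↦ γ (t + c) := by
      funext t; rw [one_mul]
    rw [h1, one_mul, one_smul] at h
    exact h
  simp only [speed_def]
  rw [hv]

/-- **Arc length of a translate**: `L(γ (· + c)|[a, b]) = L(γ|[a + c, b + c])` (translation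
invariance of Lebesgue measure). O'Neill 1983, Ch. 5, Def. 5.11. [folklore] -/
lemma arcLength_comp_add_const (γ : ℝ → M) (c a b : ℝ) :
    g.arcLength (fun t ↦ γ (t + c)) a b = g.arcLength γ (a + c) (b + c) := by
  simp only [arcLength_eq_lintegral_Icc]
  rw [← lintegral_indicator measurableSet_Icc, ← lintegral_indicator measurableSet_Icc,
    ← lintegral_add_right_eq_self (fun x ↦ (Icc (a + c) (b + c)).indicator
      (fun t ↦ ENNReal.ofReal (g.speed γ t)) x) c]
  refine lintegral_congr fun x ↦ ?_
  by_cases hx : x ∈ Icc a b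
  · have hx' : x + c ∈ Icc (a + c) (b + c) := ⟨by linarith [hx.1], by linarith [hx.2]⟩
    rw [indicator_of_mem hx, indicator_of_mem hx', speed_comp_add_const]
  · have hx' : x + c ∉ Icc (a + c) (b + c) := fun h ↦ hx ⟨by linarith [h.1], by linarith [h.2]⟩
    rw [indicator_of_notMem hx, indicator_of_notMem hx']

/-- **Exhaustion of the arc length from the inside**: if `L(γ|[a', b]) ≤ C` for all `a'` with
`a < a' < b`, then `L(γ|[a, b]) ≤ C` (the integral over `(a, b]` is the supremum of the integrals
over `[a', b]`, `a' ↓ a`; no measurability is needed). [folklore] -/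
lemma arcLength_le_of_forall_lt {γ : ℝ → M} {a b : ℝ} (hab : a < b) {C : ℝ≥0∞}
    (h : ∀ a', a < a' → a' < b → g.arcLength γ a' b ≤ C) : g.arcLength γ a b ≤ C := by
  -- `Ioc a b` as the increasing union of `Icc (a + δ k) b`, `δ k = (b - a) / (k + 2)`
  set δ : ℕ → ℝ := fun k ↦ (b - a) / ((k : ℝ) + 2) with hδ
  have hδpos : ∀ k, 0 < δ k := fun k ↦ by rw [hδ]; positivity
  have hδlt : ∀ k, δ k < b - a := fun k ↦ by
    rw [hδ, div_lt_iff₀ (by positivity)]; nlinarith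
  have hδanti : ∀ k l : ℕ, k ≤ l → δ l ≤ δ k := fun k l hkl ↦ by
    simp only [hδ]
    exact div_le_div_of_nonneg_left (by linarith) (by positivity)
      (by exact_mod_cast Nat.add_le_add_right hkl 2)
  have hU : (⋃ k : ℕ, Icc (a + δ k) b) = Ioc a b := by
    ext x
    simp only [mem_iUnion, mem_Icc, mem_Ioc]
    constructor
    · rintro ⟨k, h1, h2⟩
      exact ⟨by linarith [hδpos k], h2⟩
    · rintro ⟨h1, h2⟩
      obtain ⟨k, hk⟩ := exists_nat_gt ((b - a) / (x - a))
      refine ⟨k, ?_, h2⟩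
      have hxa : 0 < x - a := by linarith
      have hk' : (b - a) / (x - a) < (k : ℝ) + 2 := by linarith
      rw [div_lt_iff₀ hxa] at hk'
      have : δ k < x - a := by
        rw [hδ, div_lt_iff₀ (by positivity)]; linarith
      linarith
  have hdir : Directed (· ⊆ ·) fun k : ℕ ↦ Icc (a + δ k) b :=
    Monotone.directed_le fun k l hkl ↦ Icc_subset_Icc (by linarith [hδanti k l hkl]) le_rfl
  have key : g.arcLength γ a b = ⨆ k : ℕ, g.arcLength γ (a + δ k) b := by
    simp only [arcLength_eq_lintegral_Icc]
    rw [← restrict_Ioc_eq_restrict_Icc, ← hU]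
    exact setLIntegral_iUnion_of_directed _ hdir
  rw [key]
  exact iSup_le fun k ↦ h _ (by linarith [hδpos k]) (by linarith [hδlt k])

end PseudoRiemannianMetric

/-! ### The time separation is monotone under prefixing a causal curve -/

namespace LorentzianMetric

variable {g : LorentzianMetric I n M} {τ : TimeOrientation g}

/-- **A causal curve starting in `J⁺(p)` is not longer than the time separation from `p` to its
endpoint**: if `γ : [a, b] → M` is a future causal curve with `γ a ∈ J⁺(p)` then
`L(γ) ≤ d(p, γ b)`. Prefix a causal curve from `p` to `γ a`, rounding the corner inside the
parameter interval `[a, a + η]` (`exists_isFutureCausalCurveOn_trans_tail`), to get a causal curve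
from `p` to `γ b` at least as long as `γ|[a + η, b]`, and let `η → 0`
(`arcLength_le_of_forall_lt`). This is the half `τ(q, r) ≤ τ(p, r)` for `p ≤ q` of the reverse
triangle inequality, O'Neill 1983, Ch. 14, Lemma 14.16 (2) (p. 409).
[cite: ONeillSemiRiemannian1983, Ch. 14, Lemma 14.16 (2) (p. 409)] -/
theorem arcLength_le_lorentzDist_of_mem_causalFuture [BoundarylessManifold I M] (hn : 1 ≤ n)
    {p : M} {γ : ℝ → M} {a b : ℝ} (hab : a < b) (hγ : g.IsFutureCausalCurveOn τ γ (Icc a b))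
    (hp : γ a ∈ g.causalFuture τ {p}) :
    g.arcLength γ a b ≤ g.lorentzDist τ p (γ b) := by
  rcases hp with hpa | ⟨p₀, hp₀, β, a₁, b₁, hab₁, hβ, hβa, hβb⟩
  · exact arcLength_le_lorentzDist hab hγ hpa rfl
  · rw [mem_singleton_iff] at hp₀
    subst hp₀
    subst hβa
    refine PseudoRiemannianMetric.arcLength_le_of_forall_lt hab fun a' haa' ha'b ↦ ?_
    obtain ⟨Γ, a₀, b₀, s₀, c, hab₀, hΓ, hΓa, hΓb, has₀, hs₀b, hbc, hs₀c, htail⟩ :=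
      exists_isFutureCausalCurveOn_trans_tail hn hab₁ hab hβ hγ hβb (η := a' - a) (by linarith)
    calc g.arcLength γ a' b
        ≤ g.arcLength γ (s₀ + c) (b₀ + c) :=
          PseudoRiemannianMetric.arcLength_mono γ (by linarith) (by linarith)
      _ = g.arcLength (fun t ↦ γ (t + c)) s₀ b₀ :=
          (PseudoRiemannianMetric.arcLength_comp_add_const γ c s₀ b₀).symm
      _ = g.arcLength Γ s₀ b₀ :=
          PseudoRiemannianMetric.arcLength_congr_Ioo fun s hs ↦ (htail s ⟨hs.1, hs.2.le⟩).symm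
      _ ≤ g.arcLength Γ a₀ b₀ := PseudoRiemannianMetric.arcLength_mono Γ has₀ le_rfl
      _ ≤ g.lorentzDist τ (β a₁) (γ b) := arcLength_le_lorentzDist hab₀ hΓ hΓa hΓb

/-- **Monotonicity of the time separation under `≤` in the first argument**: if `q ∈ J⁺(p)` then
`d(q, r) ≤ d(p, r)` for every `r` — the half of the reverse triangle inequality
`τ(p, q) + τ(q, r) ≤ τ(p, r)` (O'Neill 1983, Ch. 14, Lemma 14.16 (2), p. 409) that drops `τ(p, q)`.
[cite: ONeillSemiRiemannian1983, Ch. 14, Lemma 14.16 (2) (p. 409)] -/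
theorem lorentzDist_le_lorentzDist_of_mem_causalFuture [BoundarylessManifold I M] (hn : 1 ≤ n)
    {p q : M} (hq : q ∈ g.causalFuture τ {p}) (r : M) :
    g.lorentzDist τ q r ≤ g.lorentzDist τ p r :=
  lorentzDist_le_lorentzDist_of_forall fun γ a b hab hγ hγa hγb ↦ by
    rw [← hγb]
    exact arcLength_le_lorentzDist_of_mem_causalFuture hn hab hγ (hγa.symm ▸ hq)

end LorentzianMetric

end Literature.Geometry.Lorentzian

end
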